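/-
Copyright (c) 2026 the pub-hodgecm-mathlib formalisation cell (harness21).  Prover seat hodgecm-mathlib-LH4-p12 (g7), req620 Track A «(D-RAM) FOUR-FRAME», line LH4
(STAGE-1b tier-0 law stubs, dealer LH4-plan (g13) WORD #58 RULING C «ONE skeleton shape for (S2b-κS) [this seat] and (L2b-κS) [F0P3a-p01 (g36)]»: the LABELLED TRUNK's steps
(1)–(2) of ★ TRUNK p857082 — partition of the label-cut dualisable set by axis into label-cut strata over the depth box, and vanishing off the ★ B3 shape list — for a GENERIC
label predicate `Q` (one token `LatticeInLevel ϖ ℓ (diag e)` for sq, two tokens for lev) and a GENERIC weight `f` (κ-weighted or not)).  2026-09-04.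
-/
import Summits.HodgeConjecture.HodgeConjecture.Theorems.F0P3cDyRamStableCountTypeZero   -- ★ (LH4-p12 lineage): `finite_normalisedStableLattices`; brings ★ `finsum_mem_eq_sum_box_finsum_mem_hasAxis`, ★ `exists_hasAxis`, ★ `hasAxis_unique`, ★ `hasAxis_shapes`
import Summits.HodgeConjecture.HodgeConjecture.Theorems.F0P3cDyRamDiagonalKappaCountDefs   -- ★ Fκ1 (LH4-p05): `kappaCount` (for the (S2b-κS) instance)
import Summits.HodgeConjecture.HodgeConjecture.Theorems.F0P3cDyRamFourFrameCensusDefs    -- ★ U2G DEFS: `LatticeInLevel`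
import HarnessLib

/-!
# Crux `H413`, line LH4 «(D-RAM) FOUR-FRAME» — THE LABELLED TRUNK SKELETON, steps (1)–(2): the label-cut dualisable sum as a box sum of label-cut strata

★ TRUNK p857082 `finsum_kappaCount_typeZero_eq_token_mul_ampl` opens with two label-free moves: (1) the summation set `{M ∈ 𝓛₀(T) | dualisable}` is finite and every member has a
unique axis vector in the box `[0, n₁+n₂+n₃]³` (★ `exists_hasAxis`, ★ `hasAxis_unique`), so the sum is the finite box sum of its axis cells (★ `finsum_mem_eq_sum_box_finsum_mem_hasAxis`);
(2) each cell is a stratum, empty off the ★ B3 shape list (★ `hasAxis_shapes`).  Both moves commute with ANY label predicate `Q` on lattices and ANY weight `f`: the cells of the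
label-cut set are the label-cut strata.  This file states exactly that, once, for every labelled law (sq: `Q = LatticeInLevel ϖ (lb d) (diag((α−1)², (β−1)², 0))`, κ-weight; lev:
two tokens; stable: weight `stabiliserWeight`), so that the (S2b-κS) ∕ (L2b-κS) labelled trunks share ONE skeleton: THIS partition + per-stratum labelled cells (split ★ p859711 ∕
★ p859655, glued∕H off-locus ★ p859714 + rotations, on-locus = LH4-p09 (g8)'s class-cut census) + a labelled box-sum.

* `finsum_mem_sep_eq_sum_box_finsum_stratum_sep (hD hE T hT Q f)` — step (1)+(2): `Σᶠ_{M ∈ 𝓛₀(T), dualisable, Q M} f M = Σ_{a ∈ [0, Σn]³} Σᶠ_{M ∈ stratum(T,a), Q M} f M`.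
* `finsum_stratum_sep_eq_zero_of_not_shape (hD T Q f)` — off the ★ B3 shape list a label-cut stratum sum is `0`.
* `finsum_mem_sep_eq_sum_box_finsum_stratum_sep_kappa` — the κ-weighted instance at the one-token level label (the (S2b-κS) currency of ★ p859650's `hTrunk`), for the record.

HONEST LABEL: helper lane (`--supports stmt-HodgeConjecture-24833`), count-neutral; partition identities only; pays no tier-0 row by itself (T₊∕T₋∕reg OPEN; the labelled trunks
stay OPEN until the on-locus cells and the labelled box-sums land); HC_CM is proved only modulo the 7 printed citations (2 remaining named inputs: hLiu418 = stmt-HodgeConjecture-24832,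
h413 = stmt-HodgeConjecture-24833) until rung 0 closes.

## References (NEVER `[KR2]`)
* [Kottwitz1986BaseChangeUnits] R. E. Kottwitz, *Base change for unit elements of Hecke algebras*, Compositio Math. 60 (1986), §1 pp. 240–241.
* [Rogawski1990] J. D. Rogawski, *Automorphic Representations of Unitary Groups in Three Variables*, Ann. of Math. Stud. 123 (1990), §4.9 Prop. 4.9.1 (a) p. 55.
* [Serre1980Trees] J.-P. Serre, *Trees*, Springer (1980), Ch. II §1.1.
-/

set_option autoImplicit false

noncomputable section

namespace Summit.HodgeConjecture.HodgeConjecture.Cruxes.H413.F0P3cDyRamLabelledKappaStrataPartition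

open Matrix
open Literature.NumberTheory.Automorphic Literature.NumberTheory.Automorphic.HermitianLattice
open Literature.NumberTheory.Automorphic.UnitaryLatticeTree Literature.NumberTheory.Automorphic.UnitaryThreeFourFrame
open Literature.NumberTheory.LocalFields Literature.NumberTheory.LocalFields.WildQuadraticDatum
open Summit.HodgeConjecture.HodgeConjecture.Cruxes.H413.F0P3cDyRamDiagonalTorusDefs
open Summit.HodgeConjecture.HodgeConjecture.Cruxes.H413.F0P3cDyRamDiagonalStrataDefs
open Summit.HodgeConjecture.HodgeConjecture.Cruxes.H413.F0P3cDyRamDiagonalKappaCountDefs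
open Summit.HodgeConjecture.HodgeConjecture.Cruxes.H413.F0P3cDyRamStrataPartition (finsum_mem_eq_sum_box_finsum_mem_hasAxis)
open Summit.HodgeConjecture.HodgeConjecture.Cruxes.H413.F0P3cDyRamDiagonalStrataAxis (exists_hasAxis hasAxis_unique)
open Summit.HodgeConjecture.HodgeConjecture.Cruxes.H413.F0P3cDyRamDiagonalStrataShapes (hasAxis_shapes)
open Summit.HodgeConjecture.HodgeConjecture.Cruxes.H413.F0P3cDyRamStableCountTypeZero (finite_normalisedStableLattices)
open Summit.HodgeConjecture.HodgeConjecture.Cruxes.H413.F0P3cDyRamFourFrameCensusDefs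
open scoped Valued WithZero Matrix MatrixGroups

variable {K : Type} [Field K] [Valued K ℤᵐ⁰] [Fintype 𝓀[K]] {σ : K →+* K} {ϖ : K} {d t : ℕ} {α β : K} {N₀ n₁ n₂ n₃ : ℕ}

/-- **STEPS (1)–(2) OF THE LABELLED TRUNK — THE LABEL-CUT DUALISABLE SUM IS THE BOX SUM OF ITS LABEL-CUT STRATA.**  For a wild datum, an element datum `(α, β; n₁, n₂, n₃)`,
`T = diag(α, β, 1)`, ANY label predicate `Q` on lattices and ANY weight `f`:
`Σᶠ_{M ∈ 𝓛₀(T), dualisable, Q M} f M = Σ_{a : Fin 3 → Fin (n₁+n₂+n₃+1)} Σᶠ_{M ∈ stratum(T, a), Q M} f M` — ★ `finsum_mem_eq_sum_box_finsum_mem_hasAxis` on the (finite, ★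
`finite_normalisedStableLattices`) label-cut set, whose members have unique axes in the box (★ `exists_hasAxis`, ★ `hasAxis_unique`); each cell is the label-cut stratum (★ `mem_stratum_iff`).
[cite: Kottwitz1986BaseChangeUnits, §1 pp. 240–241] [cite: Serre1980Trees, II §1.1] -/
theorem finsum_mem_sep_eq_sum_box_finsum_stratum_sep (hD : IsRamifiedQuadraticDatum σ ϖ d t) (hE : IsElementDatum σ ϖ N₀ α β n₁ n₂ n₃)
    (T : GL (Fin 3) K) (hT : (T : Matrix (Fin 3) (Fin 3) K) = Matrix.diagonal ![α, β, 1])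
    (Q : Submodule 𝒪[K] (Fin 3 → K) → Prop) (f : Submodule 𝒪[K] (Fin 3 → K) → ℚ) :
    ∑ᶠ M ∈ {M : Submodule 𝒪[K] (Fin 3 → K) | M ∈ normalisedStableLattices T ∧ IsDualisableLattice σ ϖ M ∧ Q M}, f M =
      ∑ a : Fin 3 → Fin (n₁ + n₂ + n₃ + 1), ∑ᶠ M ∈ {M : Submodule 𝒪[K] (Fin 3 → K) | M ∈ stratum σ ϖ T (fun j => (a j : ℕ)) ∧ Q M}, f M := by
  classical
  have hϖ : Valued.v ϖ = WithZero.exp (-1 : ℤ) := hD.2.2.1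
  set S : Set (Submodule 𝒪[K] (Fin 3 → K)) := {M | M ∈ normalisedStableLattices T ∧ IsDualisableLattice σ ϖ M ∧ Q M} with hS_def
  have hS : S.Finite := (finite_normalisedStableLattices hD hE T hT).subset fun M hM => hM.1
  have huniq : ∀ (M : Submodule 𝒪[K] (Fin 3 → K)) (a a' : Fin 3 → ℕ), HasAxis ϖ M a → HasAxis ϖ M a' → a = a' :=
    fun M a a' ha ha' => hasAxis_unique hϖ ha ha'
  have haxis : ∀ M ∈ S, ∃ a : Fin 3 → ℕ, HasAxis ϖ M a ∧ ∀ j, a j ≤ n₁ + n₂ + n₃ :=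
    fun M hM => exists_hasAxis hD hE hT hM.1
  rw [finsum_mem_eq_sum_box_finsum_mem_hasAxis huniq S hS (n₁ + n₂ + n₃) haxis f]
  refine Finset.sum_congr rfl fun a _ => ?_
  -- the cell of axis `a` of the label-cut set is the label-cut stratum of axis `a`
  have hcell : {M | M ∈ S ∧ HasAxis ϖ M (fun j => (a j : ℕ))} =
      {M : Submodule 𝒪[K] (Fin 3 → K) | M ∈ stratum σ ϖ T (fun j => (a j : ℕ)) ∧ Q M} := by
    ext M
    simp only [Set.mem_setOf_eq, hS_def, mem_stratum_iff]
    exact ⟨fun ⟨⟨h₁, h₂, h₃⟩, h₄⟩ => ⟨⟨h₁, h₂, h₄⟩, h₃⟩, fun ⟨⟨h₁, h₂, h₄⟩, h₃⟩ => ⟨⟨h₁, h₂, h₃⟩, h₄⟩⟩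
  rw [hcell]

omit [Fintype 𝓀[K]] in
/-- **OFF THE ★ B3 SHAPE LIST A LABEL-CUT STRATUM SUM VANISHES** (the stratum itself is empty by ★ `hasAxis_shapes`; any `T`, any label `Q`, any weight `f`).
[cite: Kottwitz1986BaseChangeUnits, §1 pp. 240–241] [cite: Serre1980Trees, II §1.1] -/
theorem finsum_stratum_sep_eq_zero_of_not_shape (hD : IsRamifiedQuadraticDatum σ ϖ d t) (T : GL (Fin 3) K)
    (Q : Submodule 𝒪[K] (Fin 3 → K) → Prop) (f : Submodule 𝒪[K] (Fin 3 → K) → ℚ) (a : Fin 3 → ℕ)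
    (ha : ¬ ((a = ![0, 0, 0]) ∨
      (∃ s, 2 ∣ s ∧ 2 ≤ s ∧ (a = ![0, s, s] ∨ a = ![s, 0, s] ∨ a = ![s, s, 0])) ∨
      (∃ ρ s, 1 ≤ ρ ∧ 2 ∣ s ∧ 2 ≤ s ∧ (a = ![2 * ρ, 2 * ρ + s, 2 * ρ + s] ∨ a = ![2 * ρ + s, 2 * ρ, 2 * ρ + s] ∨ a = ![2 * ρ + s, 2 * ρ + s, 2 * ρ])) ∨
      (∃ ρ, 1 ≤ ρ ∧ a = ![2 * ρ, 2 * ρ, 2 * ρ]))) :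
    ∑ᶠ M ∈ {M : Submodule 𝒪[K] (Fin 3 → K) | M ∈ stratum σ ϖ T a ∧ Q M}, f M = 0 := by
  have hempty : {M : Submodule 𝒪[K] (Fin 3 → K) | M ∈ stratum σ ϖ T a ∧ Q M} = ∅ :=
    Set.eq_empty_of_forall_notMem fun M hM => by
      obtain ⟨hM₀, hdual, hax⟩ := (mem_stratum_iff σ ϖ T a M).1 hM.1
      exact ha (hasAxis_shapes hD hM₀ hdual hax)
  rw [hempty, finsum_mem_empty]

/-- **THE (S2b-κS) INSTANCE, FOR THE RECORD**: the κ-weighted label-cut dualisable sum of ★ p859650's `hTrunk` (one level token `LatticeInLevel ϖ ℓ (diag e)`, weight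
`κ₀,ᵢ·w`) is the box sum of the labelled type-0 κ-cells `Σᶠ_{M ∈ stratum(T,a), diag(e)M ⊆ ϖ^ℓM} κ₀,ᵢ(M)·w(M)` — the cells being ★ p859711 (split), ★ p859714 (+ rotations; glued ∕ H
off the cancellation locus), LH4-p09 (g8)'s class-cut census (on the locus), and `0` off the ★ B3 shapes. [cite: Kottwitz1986BaseChangeUnits, §1 pp. 240–241]
[cite: Rogawski1990, §4.9 Prop. 4.9.1 (a) p. 55] -/
theorem finsum_mem_sep_eq_sum_box_finsum_stratum_sep_kappa (hD : IsRamifiedQuadraticDatum σ ϖ d t) (hE : IsElementDatum σ ϖ N₀ α β n₁ n₂ n₃)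
    (T : GL (Fin 3) K) (hT : (T : Matrix (Fin 3) (Fin 3) K) = Matrix.diagonal ![α, β, 1]) (i : Fin 3) (ℓ : ℕ) (e : Fin 3 → K) :
    ∑ᶠ M ∈ {M : Submodule 𝒪[K] (Fin 3 → K) | M ∈ normalisedStableLattices T ∧ IsDualisableLattice σ ϖ M ∧ LatticeInLevel ϖ ℓ (Matrix.diagonal e) M},
        (kappaCount σ ϖ 0 i M : ℚ) * stabiliserWeight σ M =
      ∑ a : Fin 3 → Fin (n₁ + n₂ + n₃ + 1),
        ∑ᶠ M ∈ {M : Submodule 𝒪[K] (Fin 3 → K) | M ∈ stratum σ ϖ T (fun j => (a j : ℕ)) ∧ LatticeInLevel ϖ ℓ (Matrix.diagonal e) M},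
          (kappaCount σ ϖ 0 i M : ℚ) * stabiliserWeight σ M :=
  finsum_mem_sep_eq_sum_box_finsum_stratum_sep hD hE T hT (fun M => LatticeInLevel ϖ ℓ (Matrix.diagonal e) M)
    fun M => (kappaCount σ ϖ 0 i M : ℚ) * stabiliserWeight σ M

end Summit.HodgeConjecture.HodgeConjecture.Cruxes.H413.F0P3cDyRamLabelledKappaStrataPartition

end
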